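import Summits.ResolutionOfSingularities.ResolutionOfSingularities.Theses.WildQuotients
import Summits.ResolutionOfSingularities.ResolutionOfSingularities.Theorems.PAlterationPicoverOfDegP
import Literature.AlgebraicGeometry.Resolution.KummerNormalForm
import Literature.AlgebraicGeometry.Motives.CartierDivisor

/-!
# `Picover` (stmt-ResolutionOfSingularities-0554): the Giraud split — glue theorem

Routes `WildQuotients` (rank 3) / `pAlteration` (rank 2) / `WildQuotient` (rank 3), crux `Picover`
(shared item stmt-0554): for every prime `p`, field `k` of characteristic `p`, regular integral
separated finite-type `k`-scheme `Y` and finite, universally injective, surjective `g : X → Y` with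
`X` integral, `Scheme.HasResolution X`.

Strategist s2 (2026-08-17), DECOMPOSITION of the crux after the line `giraud-separated-base`
(strategist s1, adopted and reshaped by lead a3; skeleton v3, registry 2026-08-17T09:41Z:
`Picover ⟸ stub_giraudNormalFormSep ∧ stub_logResolution`, every other stub PROVED). The two
children, typed here INLINE exactly as they are filed on the route (`GiraudNormalFormSep`,
`GiraudModelResolves`; cone-clean vocabulary only: `KummerNormalForm`, `MarkedIdeals`,
`CartierDivisor`, Mathlib's relative normalisation):

* (child 1, crux — the research content) **Giraud normal form of a height-one class on the
  separated regular base**: for `W` regular integral separated of finite type over `k` and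
  `L/K(W)` purely inseparable of degree `p`, some proper birational `ρ : W' → W` with `W'` integral
  regular and an snc boundary `E` such that every point of `W'` has an affine neighbourhood
  carrying a section `a` representing the class of `L` (through `ρ^♯ : K(W) ≅ K(W')`) whose germ
  at EVERY point of the neighbourhood is in `GiraudNormalFormAt` (wound/transversal or Kummer).
  Verbatim the registered stub `stub_giraudNormalFormSep`. Printed `n = 2` (Giraud 1983, Thm. 2.4,
  perfect `k`), `n = 3` (Cossart 1987, `k = k̄`); open `n ≥ 4`.
* (child 2, support — printed algebra + Kato 1994 (10.4)) **a Giraud-normal-form model resolves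
  the residue upstairs**: for such data (with `L` a `K(W')`-algebra compatibly with `ρ^♯`), the
  normalisation of `W'` in `L` has a resolution. Content: the lead's PROVED local log-regular
  charts (`localChartSep_woundCentre` p150894, `localChartSep_kummerCentre` p151531,
  `sections_normalizationIn_of_root` p150000), the atlas gluing
  `logRegularAtlas_of_localLogRegularChart` (Kato (1.5)(S)), and the NAMED FACT Kato 1994 (10.4)
  (`Kato1994_logRegular_hasResolution_general`, literature debt shared with 0557 and
  `RadicialJung.CleanResolves`).

Glue (this file, sorry-free): child 1 → child 2 → the degree-`p` residue
(`picoverDegP_of_giraudNormalFormSep`: `L` becomes a `K(W')`-algebra through the birational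
identification `K(W) ≅ K(W')`, child 2 resolves `W'^L`, the comparison `W'^L → W^L` is proper
birational — `TowerTransport.hasResolution_normalizationIn_of_isProper`, generic fibre of `ρ` =
generic point), then `OfDegP.picover_of_picoverDegP` (crux ⟸ residue, p91343). Conclusions BY
NAME for both route decls: `WildQuotients.Picover` and `PAlteration.Picover` (same body).
-/

noncomputable section

set_option linter.dupNamespace false

open CategoryTheory CategoryTheory.Limits AlgebraicGeometry TopologicalSpace
open Literature.AlgebraicGeometry.Resolution Literature.AlgebraicGeometry.Motives
open Summit.ResolutionOfSingularities.ResolutionOfSingularities.Theorems.Picover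

namespace Summit.ResolutionOfSingularities.ResolutionOfSingularities.Theorems.Picover.GiraudSplit

/-- **Child 1 → child 2 → the degree-`p` residue `PicoverDegP`.** With the Giraud-normal-form
model `ρ : W' → W` of child 1, make `L` a `K(W')`-algebra through the birational identification
`ρ^♯ : K(W) ≅ K(W')`; child 2 resolves the normalisation of `W'` in `L`; transport down the proper
birational comparison `W'^L → W^L` (the fibre of `ρ` over the generic point of `W` is the generic
point of `W'`). [folklore] -/
theorem picoverDegP_of_giraudNormalFormSep
    (hNF : ∀ p : ℕ, p.Prime → ∀ (k : Type) [Field k] [CharP k p] (W : AlgebraicGeometry.Scheme.{0}) [AlgebraicGeometry.IsIntegral W] (f : W ⟶ AlgebraicGeometry.Spec (.of k)) (L : Type) [Field L] [Algebra W.functionField L], AlgebraicGeometry.IsSeparated f → AlgebraicGeometry.LocallyOfFiniteType f → AlgebraicGeometry.QuasiCompact f → Literature.AlgebraicGeometry.Resolution.Scheme.IsRegular W → IsPurelyInseparable W.functionField L → Module.finrank W.functionField L = p → ∃ (W' : AlgebraicGeometry.Scheme.{0}) (_ : AlgebraicGeometry.IsIntegral W') (ρ : W' ⟶ W) (_ :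 AlgebraicGeometry.IsDominant ρ) (E : List W'.IdealSheafData), AlgebraicGeometry.IsProper ρ ∧ Literature.AlgebraicGeometry.Resolution.IsBirational ρ ∧ Literature.AlgebraicGeometry.Resolution.Scheme.IsRegular W' ∧ Literature.AlgebraicGeometry.Resolution.HasSNC E ∧ ∀ w' : W', ∃ (U : W'.affineOpens) (hU : w' ∈ (U : W'.Opens)) (a : W'.presheaf.obj (Opposite.op (U : W'.Opens))), (∃ (y : L) (c : W.functionField), y ∉ (algebraMap W.functionField L).range ∧ y ^ p = algebraMap W.functionField L c ∧ Literature.AlgebraicGeometry.Motives.RatFn.functionFieldMap ρ c = algebraMap (W'.presheaf.stalk w') W'.functionField (W'.presheaf.germ (U : W'.Opens) w' hU a)) ∧ ∀ (w'' : W') (hw'' : w'' ∈ (U : W'.Opens)), ∃ (r : ℕ) (D : Fin r → {D : W'.IdealSheafData // D ∈ E ∧ w'' ∈ D.support}) (x : Fin r → W'.presheaf.stalk w''), Function.Bijective D ∧ (∀ j, Literature.AlgebraicGeometry.Resolution.stalkIdeal (D j).1 w'' = Ideal.span {x j}) ∧ Literature.AlgebraicGeometry.Resolution.GiraudNormalFormAt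 p x (W'.presheaf.germ (U : W'.Opens) w'' hw'' a))
    (hRes : ∀ p : ℕ, p.Prime → ∀ (k : Type) [Field k] [CharP k p] (W : AlgebraicGeometry.Scheme.{0}) [AlgebraicGeometry.IsIntegral W] (f : W ⟶ AlgebraicGeometry.Spec (.of k)) (L : Type) [Field L] [Algebra W.functionField L] (W' : AlgebraicGeometry.Scheme.{0}) [AlgebraicGeometry.IsIntegral W'] (ρ : W' ⟶ W) [AlgebraicGeometry.IsProper ρ] [AlgebraicGeometry.IsDominant ρ] (E : List W'.IdealSheafData) [Algebra W'.functionField L], AlgebraicGeometry.IsSeparated f → AlgebraicGeometry.LocallyOfFiniteType f → AlgebraicGeometry.QuasiCompact f → (algebraMap W'.functionField L).comp (Literature.AlgebraicGeometry.Motives.RatFn.functionFieldMap ρ) = algebraMap W.functionField L → Literature.AlgebraicGeometry.Resolution.IsBirational ρ → Literature.AlgebraicGeometry.Resolution.Scheme.IsRegular W' → Literature.AlgebraicGeometry.Resolution.HasSNC E → IsPurelyInseparable W.functionField L → Module.finrank W.functionField L = p → (∀ w' : W', ∃ (U : W'.affineOpens) (hU : w' ∈ (U : W'.Opens)) (a :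 W'.presheaf.obj (Opposite.op (U : W'.Opens))), (∃ (y : L) (c : W.functionField), y ∉ (algebraMap W.functionField L).range ∧ y ^ p = algebraMap W.functionField L c ∧ Literature.AlgebraicGeometry.Motives.RatFn.functionFieldMap ρ c = algebraMap (W'.presheaf.stalk w') W'.functionField (W'.presheaf.germ (U : W'.Opens) w' hU a)) ∧ ∀ (w'' : W') (hw'' : w'' ∈ (U : W'.Opens)), ∃ (r : ℕ) (D : Fin r → {D : W'.IdealSheafData // D ∈ E ∧ w'' ∈ D.support}) (x : Fin r → W'.presheaf.stalk w''), Function.Bijective D ∧ (∀ j, Literature.AlgebraicGeometry.Resolution.stalkIdeal (D j).1 w'' = Ideal.span {x j}) ∧ Literature.AlgebraicGeometry.Resolution.GiraudNormalFormAt p x (W'.presheaf.germ (U : W'.Opens) w'' hw'' a)) → Literature.AlgebraicGeometry.Resolution.Scheme.HasResolution ((CategoryTheory.CategoryStruct.comp (AlgebraicGeometry.Spec.map (CommRingCat.ofHom (algebraMap W'.functionField L) : W'.functionField ⟶ CommRingCat.of L)) (W'.fromSpecStalk (genericPoint W'))).normalization)) :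
    ∀ (p : ℕ), p.Prime → ∀ (k : Type) [Field k] [CharP k p]
      (W : Scheme.{0}) [IsIntegral W] (f : W ⟶ Spec (.of k)) (L : Type) [Field L]
      [Algebra W.functionField L], IsSeparated f → LocallyOfFiniteType f → QuasiCompact f →
      Scheme.IsRegular W → IsPurelyInseparable W.functionField L →
      Module.finrank W.functionField L = p → Scheme.HasResolution (normalizationIn W L) := by
  intro p hp k _ _ W _ f L _ _ hsep hlft hqc hWreg hPI hdeg
  haveI : Fact p.Prime := ⟨hp⟩
  haveI : LocallyOfFiniteType f := hlft
  haveI : QuasiCompact f := hqc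
  haveI : FiniteDimensional W.functionField L :=
    Module.finite_of_finrank_pos (by rw [hdeg]; exact hp.pos)
  -- child 1: a Giraud-normal-form model `ρ : W' → W` with snc boundary `E`
  obtain ⟨W', hW'int, ρ, hdom, E, hρ, hbir, hW'reg, hE, hNF'⟩ :=
    hNF p hp k W f L hsep hlft hqc hWreg hPI hdeg
  haveI := hW'int
  haveI := hdom
  haveI := hρ
  -- `L` as a `K(W')`-algebra through the birational identification `ρ^♯ : K(W) ≅ K(W')`
  have hbij : Function.Bijective (RatFn.functionFieldMap ρ) :=
    TowerTransport.bijective_functionFieldMap_of_isIso ρ hbir.isIso_stalkMap_genericPoint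
  let e : W.functionField ≃+* W'.functionField := RingEquiv.ofBijective _ hbij
  letI : Algebra W'.functionField L :=
    ((algebraMap W.functionField L).comp e.symm.toRingHom).toAlgebra
  have halg : algebraMap W'.functionField L =
      (algebraMap W.functionField L).comp e.symm.toRingHom := rfl
  have hcompat : (algebraMap W'.functionField L).comp (RatFn.functionFieldMap ρ) =
      algebraMap W.functionField L := by
    refine RingHom.ext fun x => ?_
    rw [halg, RingHom.comp_apply, RingHom.comp_apply]
    exact congrArg (algebraMap W.functionField L) (e.symm_apply_apply x)
  -- child 2: the model resolves the normalisation of `W'` in `L`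
  have hres' : Scheme.HasResolution (normalizationIn W' L) :=
    hRes p hp k W f L W' ρ E hsep hlft hqc hcompat hbir hW'reg hE hPI hdeg hNF'
  -- finiteness of `L` over `K(W')` (same degree `p`)
  have hdeg' : Module.finrank W'.functionField L = p := by
    rw [← hdeg]
    exact Algebra.finrank_eq_of_equiv_equiv e.symm (RingEquiv.refl L) (by ext x; simp [halg])
  haveI : FiniteDimensional W'.functionField L :=
    Module.finite_of_finrank_pos (by rw [hdeg']; exact hp.pos)
  -- the fibre of `ρ` over the generic point of `W` is the generic point of `W'`
  have hfib : ∀ w' : W', ρ w' = genericPoint W → w' = genericPoint W' := by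
    intro w' hw'
    obtain ⟨U, hU, -, hUiso⟩ := hbir
    haveI := hUiso
    have hηU : genericPoint W ∈ U :=
      ((genericPoint_spec W).mem_open_set_iff U.isOpen).mpr (by simpa using hU.nonempty)
    exact TowerTransport.subsingleton_preimage_of_isIso_morphismRestrict ρ U hηU hw'
      (RatFn.genericPoint_eq_of_isDominant ρ)
  -- TRANSPORT down the proper birational comparison `W'^L → W^L`
  exact TowerTransport.hasResolution_normalizationIn_of_isProper
    FunctionFieldNormalizationIn.stub_functionField_normalizationIn W f L W' ρ hcompat hfib hres'

/-- **The Giraud split closes the crux, route `WildQuotients` spelling** (`WildQuotients.Picover`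
BY NAME): child 1 (`GiraudNormalFormSep`) → child 2 (`GiraudModelResolves`) → `Picover`, through
the residue and the landed frame `OfDegP.picover_of_picoverDegP` (the two route decls
`WildQuotients.Picover` / `PAlteration.Picover` have the same body). [folklore] -/
theorem picover_of_giraudNormalFormSep
    (hNF : ∀ p : ℕ, p.Prime → ∀ (k : Type) [Field k] [CharP k p] (W : AlgebraicGeometry.Scheme.{0}) [AlgebraicGeometry.IsIntegral W] (f : W ⟶ AlgebraicGeometry.Spec (.of k)) (L : Type) [Field L] [Algebra W.functionField L], AlgebraicGeometry.IsSeparated f → AlgebraicGeometry.LocallyOfFiniteType f → AlgebraicGeometry.QuasiCompact f → Literature.AlgebraicGeometry.Resolution.Scheme.IsRegular W → IsPurelyInseparable W.functionField L → Module.finrank W.functionField L = p → ∃ (W' : AlgebraicGeometry.Scheme.{0}) (_ : AlgebraicGeometry.IsIntegral W') (ρ : W' ⟶ W) (_ : AlgebraicGeometry.IsDominant ρ) (E : List W'.IdealSheafData), AlgebraicGeometry.IsProper ρ ∧ Literature.AlgebraicGeometry.Resolution.IsBirational ρ ∧ Literature.AlgebraicGeometry.Resolution.Scheme.IsRegular W'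 ∧ Literature.AlgebraicGeometry.Resolution.HasSNC E ∧ ∀ w' : W', ∃ (U : W'.affineOpens) (hU : w' ∈ (U : W'.Opens)) (a : W'.presheaf.obj (Opposite.op (U : W'.Opens))), (∃ (y : L) (c : W.functionField), y ∉ (algebraMap W.functionField L).range ∧ y ^ p = algebraMap W.functionField L c ∧ Literature.AlgebraicGeometry.Motives.RatFn.functionFieldMap ρ c = algebraMap (W'.presheaf.stalk w') W'.functionField (W'.presheaf.germ (U : W'.Opens) w' hU a)) ∧ ∀ (w'' : W') (hw'' : w'' ∈ (U : W'.Opens)), ∃ (r : ℕ) (D : Fin r → {D : W'.IdealSheafData // D ∈ E ∧ w'' ∈ D.support}) (x : Fin r → W'.presheaf.stalk w''), Function.Bijective D ∧ (∀ j, Literature.AlgebraicGeometry.Resolution.stalkIdeal (D j).1 w'' = Ideal.span {x j}) ∧ Literature.AlgebraicGeometry.Resolution.GiraudNormalFormAt p x (W'.presheaf.germ (U : W'.Opens) w'' hw'' a))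
    (hRes : ∀ p : ℕ, p.Prime → ∀ (k : Type) [Field k] [CharP k p] (W : AlgebraicGeometry.Scheme.{0}) [AlgebraicGeometry.IsIntegral W] (f : W ⟶ AlgebraicGeometry.Spec (.of k)) (L : Type) [Field L] [Algebra W.functionField L] (W' : AlgebraicGeometry.Scheme.{0}) [AlgebraicGeometry.IsIntegral W'] (ρ : W' ⟶ W) [AlgebraicGeometry.IsProper ρ] [AlgebraicGeometry.IsDominant ρ] (E : List W'.IdealSheafData) [Algebra W'.functionField L], AlgebraicGeometry.IsSeparated f → AlgebraicGeometry.LocallyOfFiniteType f → AlgebraicGeometry.QuasiCompact f → (algebraMap W'.functionField L).comp (Literature.AlgebraicGeometry.Motives.RatFn.functionFieldMap ρ) = algebraMap W.functionField L → Literature.AlgebraicGeometry.Resolution.IsBirational ρ → Literature.AlgebraicGeometry.Resolution.Scheme.IsRegular W' → Literature.AlgebraicGeometry.Resolution.HasSNC E → IsPurelyInseparable W.functionField L → Module.finrank W.functionField L = p → (∀ w' : W', ∃ (U : W'.affineOpens) (hU : w' ∈ (U : W'.Opens)) (a : W'.presheaf.obj (Opposite.op (U : W'.Opens))), (∃ (y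 : L) (c : W.functionField), y ∉ (algebraMap W.functionField L).range ∧ y ^ p = algebraMap W.functionField L c ∧ Literature.AlgebraicGeometry.Motives.RatFn.functionFieldMap ρ c = algebraMap (W'.presheaf.stalk w') W'.functionField (W'.presheaf.germ (U : W'.Opens) w' hU a)) ∧ ∀ (w'' : W') (hw'' : w'' ∈ (U : W'.Opens)), ∃ (r : ℕ) (D : Fin r → {D : W'.IdealSheafData // D ∈ E ∧ w'' ∈ D.support}) (x : Fin r → W'.presheaf.stalk w''), Function.Bijective D ∧ (∀ j, Literature.AlgebraicGeometry.Resolution.stalkIdeal (D j).1 w'' = Ideal.span {x j}) ∧ Literature.AlgebraicGeometry.Resolution.GiraudNormalFormAt p x (W'.presheaf.germ (U : W'.Opens) w'' hw'' a)) → Literature.AlgebraicGeometry.Resolution.Scheme.HasResolution ((CategoryTheory.CategoryStruct.comp (AlgebraicGeometry.Spec.map (CommRingCat.ofHom (algebraMap W'.functionField L) : W'.functionField ⟶ CommRingCat.of L)) (W'.fromSpecStalk (genericPoint W'))).normalization)) :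
    Summit.ResolutionOfSingularities.ResolutionOfSingularities.Theses.WildQuotients.Picover :=
  fun p hp k _ _ Y X f g hsep hlft hqc hY hYreg hX hfin hui hsurj =>
    OfDegP.picover_of_picoverDegP (picoverDegP_of_giraudNormalFormSep hNF hRes) p hp k Y X f g
      hsep hlft hqc hY hYreg hX hfin hui hsurj

/-- **The Giraud split closes the crux, route `pAlteration` spelling** (`PAlteration.Picover` BY
NAME — the crux's primary decl, stmt-0554): the same composition. [folklore] -/
theorem picover_pAlteration_of_giraudNormalFormSep
    (hNF : ∀ p : ℕ, p.Prime → ∀ (k : Type) [Field k] [CharP k p] (W : AlgebraicGeometry.Scheme.{0}) [AlgebraicGeometry.IsIntegral W] (f : W ⟶ AlgebraicGeometry.Spec (.of k)) (L : Type) [Field L] [Algebra W.functionField L], AlgebraicGeometry.IsSeparated f → AlgebraicGeometry.LocallyOfFiniteType f → AlgebraicGeometry.QuasiCompact f → Literature.AlgebraicGeometry.Resolution.Scheme.IsRegular W → IsPurelyInseparable W.functionField L → Module.finrank W.functionField L = p → ∃ (W' : AlgebraicGeometry.Scheme.{0}) (_ : AlgebraicGeometry.IsIntegral W') (ρ : W'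 ⟶ W) (_ : AlgebraicGeometry.IsDominant ρ) (E : List W'.IdealSheafData), AlgebraicGeometry.IsProper ρ ∧ Literature.AlgebraicGeometry.Resolution.IsBirational ρ ∧ Literature.AlgebraicGeometry.Resolution.Scheme.IsRegular W' ∧ Literature.AlgebraicGeometry.Resolution.HasSNC E ∧ ∀ w' : W', ∃ (U : W'.affineOpens) (hU : w' ∈ (U : W'.Opens)) (a : W'.presheaf.obj (Opposite.op (U : W'.Opens))), (∃ (y : L) (c : W.functionField), y ∉ (algebraMap W.functionField L).range ∧ y ^ p = algebraMap W.functionField L c ∧ Literature.AlgebraicGeometry.Motives.RatFn.functionFieldMap ρ c = algebraMap (W'.presheaf.stalk w') W'.functionField (W'.presheaf.germ (U : W'.Opens) w' hU a)) ∧ ∀ (w'' : W') (hw'' : w'' ∈ (U : W'.Opens)), ∃ (r : ℕ) (D : Fin r → {D : W'.IdealSheafData // D ∈ E ∧ w'' ∈ D.support}) (x : Fin r → W'.presheaf.stalk w''), Function.Bijective D ∧ (∀ j, Literature.AlgebraicGeometry.Resolution.stalkIdeal (D j).1 w'' = Ideal.span {x j}) ∧ Literature.AlgebraicGeometry.Resolution.GiraudNormalFormAt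 p x (W'.presheaf.germ (U : W'.Opens) w'' hw'' a))
    (hRes : ∀ p : ℕ, p.Prime → ∀ (k : Type) [Field k] [CharP k p] (W : AlgebraicGeometry.Scheme.{0}) [AlgebraicGeometry.IsIntegral W] (f : W ⟶ AlgebraicGeometry.Spec (.of k)) (L : Type) [Field L] [Algebra W.functionField L] (W' : AlgebraicGeometry.Scheme.{0}) [AlgebraicGeometry.IsIntegral W'] (ρ : W' ⟶ W) [AlgebraicGeometry.IsProper ρ] [AlgebraicGeometry.IsDominant ρ] (E : List W'.IdealSheafData) [Algebra W'.functionField L], AlgebraicGeometry.IsSeparated f → AlgebraicGeometry.LocallyOfFiniteType f → AlgebraicGeometry.QuasiCompact f → (algebraMap W'.functionField L).comp (Literature.AlgebraicGeometry.Motives.RatFn.functionFieldMap ρ) = algebraMap W.functionField L → Literature.AlgebraicGeometry.Resolution.IsBirational ρ → Literature.AlgebraicGeometry.Resolution.Scheme.IsRegular W' → Literature.AlgebraicGeometry.Resolution.HasSNC E → IsPurelyInseparable W.functionField L → Module.finrank W.functionField L = p → (∀ w' : W', ∃ (U : W'.affineOpens) (hU : w' ∈ (U : W'.Opens)) (a :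 W'.presheaf.obj (Opposite.op (U : W'.Opens))), (∃ (y : L) (c : W.functionField), y ∉ (algebraMap W.functionField L).range ∧ y ^ p = algebraMap W.functionField L c ∧ Literature.AlgebraicGeometry.Motives.RatFn.functionFieldMap ρ c = algebraMap (W'.presheaf.stalk w') W'.functionField (W'.presheaf.germ (U : W'.Opens) w' hU a)) ∧ ∀ (w'' : W') (hw'' : w'' ∈ (U : W'.Opens)), ∃ (r : ℕ) (D : Fin r → {D : W'.IdealSheafData // D ∈ E ∧ w'' ∈ D.support}) (x : Fin r → W'.presheaf.stalk w''), Function.Bijective D ∧ (∀ j, Literature.AlgebraicGeometry.Resolution.stalkIdeal (D j).1 w'' = Ideal.span {x j}) ∧ Literature.AlgebraicGeometry.Resolution.GiraudNormalFormAt p x (W'.presheaf.germ (U : W'.Opens) w'' hw'' a)) → Literature.AlgebraicGeometry.Resolution.Scheme.HasResolution ((CategoryTheory.CategoryStruct.comp (AlgebraicGeometry.Spec.map (CommRingCat.ofHom (algebraMap W'.functionField L) : W'.functionField ⟶ CommRingCat.of L)) (W'.fromSpecStalk (genericPoint W'))).normalization)) :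
    Summit.ResolutionOfSingularities.ResolutionOfSingularities.Theses.PAlteration.Picover :=
  OfDegP.picover_of_picoverDegP (picoverDegP_of_giraudNormalFormSep hNF hRes)

/-- **The split, BY NAME on the route items** (rev 7 of `Theses/WildQuotients.lean`: the two
children were filed by strategist s2 as the support items `GiraudNormalFormSep`
(stmt-ResolutionOfSingularities-18001) and `GiraudModelResolves` (stmt-18002)):
`GiraudNormalFormSep → GiraudModelResolves → Picover` — the type of the glue item that
`ledger route edit … --split Picover --into … --glue-by <this decl>` expects; certifies that the
items' statements and the inline bodies above agree definitionally. [folklore] -/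
theorem picover_of_giraudNormalFormSep_items :
    Summit.ResolutionOfSingularities.ResolutionOfSingularities.Theses.WildQuotients.GiraudNormalFormSep →
    Summit.ResolutionOfSingularities.ResolutionOfSingularities.Theses.WildQuotients.GiraudModelResolves →
    Summit.ResolutionOfSingularities.ResolutionOfSingularities.Theses.WildQuotients.Picover :=
  fun hNF hRes => picover_of_giraudNormalFormSep hNF hRes

/-- The same edge into the crux's primary decl `PAlteration.Picover` (stmt-0554). [folklore] -/
theorem picover_pAlteration_of_giraudNormalFormSep_items :
    Summit.ResolutionOfSingularities.ResolutionOfSingularities.Theses.WildQuotients.GiraudNormalFormSep →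
    Summit.ResolutionOfSingularities.ResolutionOfSingularities.Theses.WildQuotients.GiraudModelResolves →
    Summit.ResolutionOfSingularities.ResolutionOfSingularities.Theses.PAlteration.Picover :=
  fun hNF hRes => picover_pAlteration_of_giraudNormalFormSep hNF hRes

end Summit.ResolutionOfSingularities.ResolutionOfSingularities.Theorems.Picover.GiraudSplit

end
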